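import Summits.PneNP.PneNP.Theorems.PhaseTwinsPolyDepthTwinsAboveDefs
import Literature.Computability.Complexity.HardcoreInapproximability
import Literature.ModelTheory.FiniteModelTheory.CFIMatchingGraphs

/-!
# Route PhaseTwins, crux `PolyDepthTwinsAbove` (stmt-PneNP-2719): the cover-wired CFI graphs of the line
`annealed-cover-twins` (definitions)

Objects posited by the line `annealed-cover-twins` for the crux `PhaseTwins.PolyDepthTwinsAbove` (skeleton
`Summits/PneNP/PneNP/Cruxes/PolyDepthTwinsAbove/Lines/annealed-cover-twins.lean`, whose registered stubs are stated
in exactly this vocabulary and namespace), on the vertex type `PWVert M n' κ` and with the ten-vertex CFI complex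
(`cxW`, `occP`, `canonEnd`) of the sibling definitions file `PhaseTwinsPolyDepthTwinsAboveDefs`:

* `fpfInv`, `GSample n' dm` — fixed-point-free involutions (perfect matchings) of `Fin n'`; the randomness of ONE
  cover gadget = `dm` of them; `IsPortMatching P τ` — a perfect matching `τ` of the non-port indices;
* `gadRel`/`gadGraph τ σ` — one cover gadget: the bipartite double cover `(a, x) — (a+1, y)` of the multigraph
  `σ₁ ∪ … ∪ σ_dm ∪ τ` on `Fin n'`; `PortPat`, `gadPat` — port patterns; `gadG` (annealed restricted partition
  function of one gadget, by port pattern), `gadTot` (its total); `layerOcc`, `prodLaw`, `mixLaw` — the product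
  port law in a phase and the symmetric mixture of the two;
* `acRel`/`acGraph R P τ S c` — the cover-wired CFI graph over a cubic rotation map `R` with charges `c`: one
  cover gadget per canonical dart, `κ` CFI complexes per base vertex, the end `(w, i, a, j)` plugged into layer `a`
  of the gadget of the edge of `(w, i)`; `annZ` — its annealed partition function (sum over all gadget samples);
* `seen`, `acA`, `cxF` — the phases seen by a complex, the Tseitin-type main term `A_c`, and `F_e^κ`;
* `xlogx`, `coverPsi`, `coverLambda`, `Adm`, `profDist`, `CoverGap` — the annealed exponent of the cover gadget
  as a function of the type profile `ν` on `{00,10,01,11}` and the pair profile `(u, v)`, its admissible polytope,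
  and the variational statement (global maximum at the two product phase profiles with a power-law gap) that the
  line's stub `stub_coverGap` asserts and `stub_annealedPortLaw` consumes.

Definitions only (no facts are asserted) plus the adjacency-unfolding lemmas `acGraph_adj`, `gadGraph_adj`; the
stubs and the composition live in the skeleton and land as `PhaseTwinsPolyDepthTwinsAboveAc*.lean`. Sources of the
construction: Sly 2010 §2.1–2.2 (phases, port laws `q^±`); Cai–Fürer–Immerman 1992 §6 (the inner/end complex);
bipartite double covers / 2-lifts (deck symmetry `(a, x) ↦ (a+1, x)`); the first-moment (annealed) method for
random regular graphs built from perfect matchings (Mossel–Weitz–Wormald 2009 Prop. 3.1, as in the tree's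
`mww_firstMoment`). [folklore]
-/

noncomputable section

open scoped Classical BigOperators

namespace Summit.PneNP.PneNP.Cruxes.PolyDepthTwinsAbove.AnnealedCoverTwins

open Finset
open Summit.PneNP.PneNP.Cruxes.PolyDepthTwinsAbove.ParityWiredPorts (PWVert canonEnd occP cxW)
open Literature.Computability.Complexity (hardcoreZOn)
open Literature.Computability.Complexity.Expander (RotGraph)
open Literature.ModelTheory.FiniteModelTheory.TseitinColouring (Dart)
open Literature.ModelTheory.FiniteModelTheory.CFIMatching (bit Canon)
open Literature.Probability.LatticeModels (independencePolynomial)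

set_option linter.dupNamespace false

variable {M n' κ dm : ℕ}

/-! ## The construction -/

/-- Fixed-point-free involutions of a finite type (its perfect matchings, as permutations). -/
def fpfInv (α : Type*) [DecidableEq α] [Fintype α] : Finset (Equiv.Perm α) :=
  Finset.univ.filter fun σ => (∀ x, σ (σ x) = x) ∧ ∀ x, σ x ≠ x

/-- The randomness of ONE cover gadget: `dm = d - 1` independent uniform perfect matchings of `Fin n'`. -/
def GSample (n' dm : ℕ) : Finset (Fin dm → Equiv.Perm (Fin n')) :=
  Fintype.piFinset fun _ => fpfInv (Fin n')

/-- `τ` is a perfect matching of the NON-port indices: an involution of `Fin n'` whose fixed points are exactly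
the `2κ` port indices `P (s, j)` (so ports have gadget-degree `d - 1`, bulk vertices `d`). -/
structure IsPortMatching (P : Fin 2 × Fin κ ↪ Fin n') (τ : Equiv.Perm (Fin n')) : Prop where
  invol : ∀ x, τ (τ x) = x
  fixed_iff : ∀ x, τ x = x ↔ x ∈ Set.range P

/-- Generating adjacency of one cover gadget on `ZMod 2 × Fin n'` (layer, index): the bipartite double cover of
`M₁ ∪ … ∪ M_{dm} ∪ τ`. -/
def gadRel (τ : Equiv.Perm (Fin n')) (σ : Fin dm → Equiv.Perm (Fin n')) :
    ZMod 2 × Fin n' → ZMod 2 × Fin n' → Prop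
  | (a, x), (b, y) => b = a + 1 ∧ x ≠ y ∧ ((∃ i, σ i x = y) ∨ τ x = y)

/-- One cover gadget (the deck-symmetric core `R_σ × K₂` of the idea card, ports included). -/
def gadGraph (τ : Equiv.Perm (Fin n')) (σ : Fin dm → Equiv.Perm (Fin n')) : SimpleGraph (ZMod 2 × Fin n') :=
  SimpleGraph.fromRel (gadRel τ σ)

/-- Port patterns: occupancy of the port vertex (layer `a`, index `P (s, j)`), as a function of `((s, j), a)`. -/
abbrev PortPat (κ : ℕ) : Type := (Fin 2 × Fin κ) × ZMod 2 → Bool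

/-- The port pattern of a gadget configuration. -/
def gadPat (P : Fin 2 × Fin κ ↪ Fin n') (I : Finset (ZMod 2 × Fin n')) : PortPat κ :=
  fun q => decide ((q.2, P q.1) ∈ I)

/-- `G(k)`: the ANNEALED restricted partition function of one gadget — total `λ`-weight, summed over the gadget
randomness, of the independent sets with port pattern `k`. -/
def gadG (P : Fin 2 × Fin κ ↪ Fin n') (τ : Equiv.Perm (Fin n')) (dm : ℕ) (lam : ℝ) (k : PortPat κ) : ℝ :=
  ∑ σ ∈ GSample n' dm, hardcoreZOn (gadGraph τ σ) lam (fun I => gadPat P I = k)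

/-- `Σ_k G(k) = Σ_σ Z(gadget)`: the annealed partition function of one gadget. -/
def gadTot (τ : Equiv.Perm (Fin n')) (dm : ℕ) (lam : ℝ) : ℝ :=
  ∑ σ ∈ GSample n' dm, independencePolynomial (gadGraph τ σ) lam

/-- Occupation probability of layer `a` of a gadget in phase `s` (`true` = layer `0` dense): `q⁺` for
`(s, a) = (true, 0), (false, 1)`, `q⁻` otherwise (the sibling line's `occP`). -/
def layerOcc (qp qm : ℝ) (s : Bool) (a : ZMod 2) : ℝ := occP qp qm (if a = 0 then s else !s)

/-- The PRODUCT port law in phase `s`: port vertices independent, layer `a` occupied w.p. `layerOcc qp qm s a`. -/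
def prodLaw (qp qm : ℝ) (s : Bool) (k : PortPat κ) : ℝ :=
  ∏ q, (if k q then layerOcc qp qm s q.2 else 1 - layerOcc qp qm s q.2)

/-- The symmetric mixture of the two product port laws (deck symmetry: both phases have weight `1/2`). -/
def mixLaw (qp qm : ℝ) (k : PortPat κ) : ℝ := (prodLaw qp qm true k + prodLaw qp qm false k) / 2

/-- Generating adjacency of the cover-wired CFI graph `acGraph R P τ S c`: (gadget) for CANONICAL `δ` the cover
gadget of the sample `S δ` on `{δ} × ZMod 2 × Fin n'` (non-canonical darts carry isolated junk, identical for all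
charges); (end–gadget) the end `(w, i, a, j)` is adjacent to the port vertex `(δ, a, P (s, j))` of the gadget
`(δ, s) = canonEnd R (w, i)` — layer `a` of ONE gadget; (inner–end) `(w, S', j) — (w, i, bit (c w) S' i, j)`. -/
def acRel (R : RotGraph M 3) (P : Fin 2 × Fin κ ↪ Fin n') (τ : Equiv.Perm (Fin n'))
    (S : Dart M 3 → Fin dm → Equiv.Perm (Fin n')) (c : Fin M → ZMod 2) :
    PWVert M n' κ → PWVert M n' κ → Prop
  | .inl (δ, a, x), .inl (δ', b, y) =>
      Canon R δ ∧ δ' = δ ∧ b = a + 1 ∧ x ≠ y ∧ ((∃ i, S δ i x = y) ∨ τ x = y)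
  | .inr (.inl (w, i, a, j)), .inl (δ', a', y) =>
      a' = a ∧ δ' = (canonEnd R (w, i)).1 ∧ y = P ((canonEnd R (w, i)).2, j)
  | .inr (.inr (w, S', j)), .inr (.inl (w', i, a, j')) => w' = w ∧ j' = j ∧ bit (c w) S' i = a
  | _, _ => False

/-- **The cover-wired CFI graph** over the base `R`, ports `P`, port matching `τ`, gadget sample `S`, charges `c`. -/
def acGraph (R : RotGraph M 3) (P : Fin 2 × Fin κ ↪ Fin n') (τ : Equiv.Perm (Fin n'))
    (S : Dart M 3 → Fin dm → Equiv.Perm (Fin n')) (c : Fin M → ZMod 2) : SimpleGraph (PWVert M n' κ) :=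
  SimpleGraph.fromRel (acRel R P τ S c)

/-- **The annealed partition function** `Σ_S Z(acGraph R P τ S c, λ)` over all gadget samples. -/
def annZ (R : RotGraph M 3) (P : Fin 2 × Fin κ ↪ Fin n') (τ : Equiv.Perm (Fin n')) (dm : ℕ)
    (c : Fin M → ZMod 2) (lam : ℝ) : ℝ :=
  ∑ S ∈ Fintype.piFinset (fun _ : Dart M 3 => GSample n' dm), independencePolynomial (acGraph R P τ S c) lam

/-- The phases SEEN by the complex at `w` under the edge phases `Y` (read at canonical darts): the end `(i, 0)`
sees layer `0` of the gadget of edge `(w, i)` (phase `Y`), the end `(i, 1)` layer `1` (phase `¬Y`) — so that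
`occP qp qm (seen R Y w (i, a)) = layerOcc qp qm (Y δ) a`; all `Y = true` is the reference pattern of `pwPsi`. -/
def seen (R : RotGraph M 3) (Y : Dart M 3 → Bool) (w : Fin M) : Fin 3 × ZMod 2 → Bool :=
  fun p => if p.2 = 0 then Y (canonEnd R (w, p.1)).1 else !Y (canonEnd R (w, p.1)).1

/-- **The Tseitin-type sum** `A_c = Σ_{Y : Dart → Bool} Π_w cxW(c w; seen Y w)^κ`: the main term of the annealed
partition function once the port law is the mixture of product laws (one phase bit per edge; `Y` is read only at
canonical darts, the other coordinates contribute a charge-independent power of `2`). -/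
def acA (R : RotGraph M 3) (lam qp qm : ℝ) (κ : ℕ) (c : Fin M → ZMod 2) : ℝ :=
  ∑ Y : Dart M 3 → Bool, ∏ w : Fin M, cxW lam qp qm (c w) (seen R Y w) ^ κ

/-- `F_e^κ`: the `κ`-th power of the complex factor with local charge `e` in the reference pattern of `pwPsi`. -/
def cxF (lam qp qm : ℝ) (κ : ℕ) (e : ZMod 2) : ℝ := cxW lam qp qm e (fun p => decide (p.2 = 0)) ^ κ

/-! ## The annealed exponent of the cover gadget (from the ideator's `Sketch-ideator3.lean`) -/

/-- `x log x` (with Mathlib's `Real.log 0 = 0`, so `xlogx 0 = 0`). -/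
def xlogx (x : ℝ) : ℝ := x * Real.log x

/-- The entropy part of the annealed exponent at a type profile `ν = (ν₀₀, ν₁₀, ν₀₁, ν₁₁)` (types `(s₀, s₁)` =
occupied in layer `0` / layer `1`) and allowed pair-type frequencies, free variables `u = q_{00,10}`, `v = q_{00,01}`
(forced: `q_{10,10} = (ν₁₀-u)/2`, `q_{01,01} = (ν₀₁-v)/2`, `q_{00,11} = ν₁₁`, `q_{00,00} = (ν₀₀-u-v-ν₁₁)/2`;
forbidden pairs `{10,01},{10,11},{01,11},{11,11}`). -/
def coverPsi (ν₀₀ ν₁₀ ν₀₁ ν₁₁ u v : ℝ) : ℝ :=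
  (-(xlogx u + xlogx v + xlogx ν₁₁))
    - (xlogx ((ν₁₀ - u) / 2) + (ν₁₀ - u) / 2 * Real.log 2)
    - (xlogx ((ν₀₁ - v) / 2) + (ν₀₁ - v) / 2 * Real.log 2)
    - (xlogx ((ν₀₀ - u - v - ν₁₁) / 2) + (ν₀₀ - u - v - ν₁₁) / 2 * Real.log 2)

/-- The annealed exponent `Λ_{d,λ}(ν; u, v) = (d-1) Σ_s ν_s log ν_s + (ν₁₀+ν₀₁+2ν₁₁) log λ + d·coverPsi` of
`E_σ Z(cover gadget)` at type profile `ν` and pair profile `(u, v)` (`(1/n') log` of #type assignments × weight ×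
(avoidance probability)^d). -/
def coverLambda (d : ℕ) (lam ν₀₀ ν₁₀ ν₀₁ ν₁₁ u v : ℝ) : ℝ :=
  ((d : ℝ) - 1) * (xlogx ν₀₀ + xlogx ν₁₀ + xlogx ν₀₁ + xlogx ν₁₁)
    + (ν₁₀ + ν₀₁ + 2 * ν₁₁) * Real.log lam
    + (d : ℝ) * coverPsi ν₀₀ ν₁₀ ν₀₁ ν₁₁ u v

/-- Admissible `(ν₁₀, ν₀₁, ν₁₁, u, v)` (`ν₀₀ = 1 - ν₁₀ - ν₀₁ - ν₁₁`): all type and pair frequencies nonnegative. -/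
def Adm (ν₁₀ ν₀₁ ν₁₁ u v : ℝ) : Prop :=
  0 ≤ ν₁₀ ∧ 0 ≤ ν₀₁ ∧ 0 ≤ ν₁₁ ∧ ν₁₀ + ν₀₁ + ν₁₁ ≤ 1 ∧
    0 ≤ u ∧ u ≤ ν₁₀ ∧ 0 ≤ v ∧ v ≤ ν₀₁ ∧ u + v + ν₁₁ ≤ 1 - ν₁₀ - ν₀₁ - ν₁₁

/-- `ℓ_∞`-distance of `(ν₁₀, ν₀₁, ν₁₁, u, v)` to the PRODUCT phase profile with layer densities `(α, β)`
(`ν₁₀ = α(1-β)`, `ν₀₁ = (1-α)β`, `ν₁₁ = αβ`) and pair point `(u₀, v₀)`. -/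
def profDist (α β u₀ v₀ ν₁₀ ν₀₁ ν₁₁ u v : ℝ) : ℝ :=
  max (max |ν₁₀ - α * (1 - β)| |ν₀₁ - (1 - α) * β|) (max |ν₁₁ - α * β| (max |u - u₀| |v - v₀|))

/-- **The variational input of the line (shape of the conclusion of `stub_coverGap`).** The annealed exponent is
maximal on the admissible polytope exactly at the two product phase profiles — layer densities `(p⁺, p⁻)` with
its optimal pair point `(u*, v*)`, and the deck-swapped `(p⁻, p⁺)` with `(v*, u*)` — with a POWER-LAW gap:
`Λ(ν,u,v) + C · min(dist to the one, dist to the other)^ℓ ≤ Λ(ν⁺, u*, v*)`. -/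
def CoverGap (d : ℕ) (lam pp pm : ℝ) : Prop :=
  ∃ us vs : ℝ, Adm (pp * (1 - pm)) ((1 - pp) * pm) (pp * pm) us vs ∧
    ∃ (ℓ : ℕ) (C : ℝ), 0 < C ∧ ∀ ν₁₀ ν₀₁ ν₁₁ u v : ℝ, Adm ν₁₀ ν₀₁ ν₁₁ u v →
      coverLambda d lam (1 - ν₁₀ - ν₀₁ - ν₁₁) ν₁₀ ν₀₁ ν₁₁ u v +
          C * min (profDist pp pm us vs ν₁₀ ν₀₁ ν₁₁ u v) (profDist pm pp vs us ν₁₀ ν₀₁ ν₁₁ u v) ^ ℓ ≤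
        coverLambda d lam ((1 - pp) * (1 - pm)) (pp * (1 - pm)) ((1 - pp) * pm) (pp * pm) us vs

/-! ## Unfolding lemmas -/

/-- Adjacency of the cover-wired graph: the symmetrised, irreflexive closure of `acRel`. -/
theorem acGraph_adj (R : RotGraph M 3) (P : Fin 2 × Fin κ ↪ Fin n') (τ : Equiv.Perm (Fin n'))
    (S : Dart M 3 → Fin dm → Equiv.Perm (Fin n')) (c : Fin M → ZMod 2) (x y : PWVert M n' κ) :
    (acGraph R P τ S c).Adj x y ↔ x ≠ y ∧ (acRel R P τ S c x y ∨ acRel R P τ S c y x) :=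
  SimpleGraph.fromRel_adj _ _ _

/-- Adjacency of one cover gadget: the symmetrised, irreflexive closure of `gadRel`. -/
theorem gadGraph_adj (τ : Equiv.Perm (Fin n')) (σ : Fin dm → Equiv.Perm (Fin n')) (p q : ZMod 2 × Fin n') :
    (gadGraph τ σ).Adj p q ↔ p ≠ q ∧ (gadRel τ σ p q ∨ gadRel τ σ q p) :=
  SimpleGraph.fromRel_adj _ _ _

end Summit.PneNP.PneNP.Cruxes.PolyDepthTwinsAbove.AnnealedCoverTwins
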